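/-
Copyright (c) 2026. All rights reserved.
Released under Apache 2.0 license as described in the file LICENSE.
-/
import Literature.Combinatorics.Designs.ProjectiveGeometryDesigns
import Mathlib.Algebra.Module.ZMod
import HarnessLib

/-!
# The subgroups of an elementary abelian `p`-group counted by Gaussian binomials: all subgroups of order
# `pᵈ` (`[n; d]_p`), those through a given element (`[n−1; d−1]_p`), those avoiding it (`pᵈ·[n−1; d]_p`)
# (Chebolu–Lockridge Thm. 2.2 / Lemma 3.2; Cohn Thm. 1; Hirschfeld Thm. 3.1.1 (iii))

Topic `GroupTheory/FiniteAbelian`; namespace `Literature.GroupTheory.FiniteAbelian.ElementaryAbelianSubgroupCount`.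
Lane `lit-hodgefound` (Track 2 foundations library), prover seat `lit-hodgefound-p10` generation 45, row g45-#1.
THEOREMS ONLY: no definition, no named fact, no instance, no notation, net debt 0.

SETTING.  `G` a finite commutative group, written MULTIPLICATIVELY, of prime exponent `p` (`g^p = 1` for all
`g`; no `𝔽_p`-module structure is assumed on `G` — the statements are instance-free and apply verbatim to a
Galois group `Gal(K/ℚ) ≅ (ℤ/2)ⁿ` of a multiquadratic field or to the groups of the lane's CM-type files), of
order `#G = pⁿ`; `ρ ∈ G`, `ρ ≠ 1` a marked element; `[n; d]_q` the Gaussian binomial (the tree's `qBinomial`,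
`Literature.Combinatorics.Enumerative`, values in `ℤ`).

THE PRINT.  S. K. Chebolu, K. Lockridge [CheboluLockridge2022] §2 (held text `paper:arxiv-2108.10956`
chunk p0004): «it is well known that `binom{n}{k}_q` counts the number of subspaces of dimension `k` in an
`n`-dimensional vector space over the finite field `𝔽_q` … counting subspaces of an `𝔽_p`-vector space is
the same as counting subgroups: the two concepts coincide since `p` is prime», **Theorem 2.2**: «Let `V` be an
`n`-dimensional `𝔽_p`-vector space. … The number of subspaces of `V` with dimension `k` is `binom{n}{k}_p`»,
and §3 **Lemma 3.2** (chunk p0005): «The map `π` induces a one-to-one correspondence between the subgroups of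
`G` that contain `Φ(G)` and the subspaces of `𝔽_pⁿ`» (the correspondence theorem).  H. Cohn [Cohn2004]
**Theorem 1** is the subspace count itself (the tree's `card_finrank_eq_qBinomial`), and J. W. P. Hirschfeld
[Hirschfeld1979] **Theorem 3.1.1 (iii)** the number of `r`-spaces through a fixed `s`-space (the tree's
`card_subspaces_containing_eq_qBinomial`: the `d`-dimensional subspaces through a fixed line number
`[n−1; d−1]_q`).

WHAT IS PROVED (all `theorem`s; the `𝔽_p`-structure `Additive G` with `AddCommGroup.zmodModule` is built
INSIDE the proofs, subgroups are carried to subspaces by Mathlib's `Subgroup.toAddSubgroup` and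
`AddSubgroup.toZModSubmodule`, orders `pᵈ` to dimensions `d`):

* §1 **`natCard_subgroup_eq_qBinomial`** — `#{H ≤ G : #H = pᵈ} = [n; d]_p` (Chebolu–Lockridge Thm. 2.2 in
  group form; the additive, module-bound form is the tree's
  `NumberTheory/ModularForms/HeckeGLnPiOperatorsGaussianBinomial.natCard_addSubgroup_natCard_eq_prime_pow`).
* §2 **`natCard_subgroup_mem_eq_qBinomial`** — `#{H : #H = p^{d+1}, ρ ∈ H} = [n−1; d]_p` (the subgroups
  through `ρ` are the subgroups of `G/⟨ρ⟩`; Hirschfeld 3.1.1 (iii) with `s`-space = the line `⟨ρ⟩`).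
* §3 **`natCard_subgroup_not_mem_eq`** — `#{H : #H = pᵈ, ρ ∉ H} = pᵈ·[n−1; d]_p` when `#G = pⁿ`, `n ≥ 1`
  (difference of §1 and §2 and the `q`-Pascal rule `[n; d] = pᵈ[n−1; d] + [n−1; d−1]`); in particular
  (`natCard_subgroup_not_mem_index_eq`) exactly `p^{n−1}` hyperplanes (subgroups of index `p`) avoid `ρ`.
* §4 the same three counts as cardinalities of `Finset.filter`s over `Finset.univ : Finset (Subgroup G)`.
* §5 `p = 2`, THE TABLES used by the lane's census of partially-bent CM types (exponent-`2` groups of order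
  `8, 16, 32, 64`, subgroups `W ∌ ρ` by order): `card_filter_not_mem_of_card_eq_sixtyFour` — order `64`:
  `62, 620, 1240, 496, 32` subgroups of order `2, 4, 8, 16, 32` avoiding `ρ` (`card_filter_eight_of_card_eq_sixtyFour`:
  `1395 = [6; 3]_2` of order `8` in all, `155` of them through `ρ`; `card_filter_not_mem_eq_of_card_eq_sixtyFour`:
  `2451` subgroups avoid `ρ` in all); `…_of_card_eq_thirtyTwo`: `30, 140, 120, 16`; `…_of_card_eq_sixteen`:
  `14, 28, 8`; `…_of_card_eq_eight`: `1, 6, 4` (orders `1, 2, 4`).  The case `d = 1`, `p = 2` (`#G − 2`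
  subgroups of order `2` avoid `ρ`) is the tree's `Pohlmann1968/MultiquadraticCMFieldIndexTwoCMSubfields`
  (`ncard_natCard_eq_two_not_mem_add_two`), not restated.

HONEST SCOPE.  Chebolu–Lockridge print the subspace/subgroup dictionary and the count `[n; k]_p`; the
refinement by a marked element (§2–§3) is this file's bookkeeping on Hirschfeld's through-a-subspace count, and
the numerical tables are kernel evaluations of the `q`-Pascal recursion.  Nothing here is specific to CM types.

## References

* [CheboluLockridge2022] S. K. Chebolu, K. Lockridge, *Gaussian Binomial Coefficients in Group Theory, Field
  Theory, and Topology*, Amer. Math. Monthly 129 (2022) 466–473 — §2 Theorem 2.2, §3 Lemma 3.2, Theorem 3.3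
  (held `paper:arxiv-2108.10956`, chunks p0004–p0005).
* [Cohn2004] H. Cohn, *Projective geometry over `𝔽₁` and the Gaussian binomial coefficients*, Amer. Math.
  Monthly 111 (2004) — Theorem 1 (the tree's `LinearAlgebra/Subspace/GaussianBinomialCount`).
* [Hirschfeld1979] J. W. P. Hirschfeld, *Projective Geometries over Finite Fields*, OUP 1979 — §3.1 Theorem
  3.1.1 (iii) (the tree's `Combinatorics/Designs/ProjectiveGeometryDesigns`).

## Provenance

Lane `lit-hodgefound`, seat p10 generation 45, row g45-#1 (own row, claimed by path); gen-44 successor menu (c)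
«Gaussian-binomial API at group level».  Used by name, nothing restated: `card_finrank_eq_qBinomial`,
`card_subspaces_containing_eq_qBinomial`, `qBinomial_succ_succ`, Mathlib `AddCommGroup.zmodModule`,
`AddSubgroup.toZModSubmodule`, `Subgroup.toAddSubgroup`, `Module.natCard_eq_pow_finrank`, `finrank_span_singleton`.
-/

open scoped Classical
open Module Finset
open Literature.Combinatorics.Enumerative
open Literature.LinearAlgebra.Subspace (card_finrank_eq_qBinomial)
open Literature.Combinatorics.Designs.ProjectiveGeometryDesigns (card_subspaces_containing_eq_qBinomial)

namespace Literature.GroupTheory.FiniteAbelian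

namespace ElementaryAbelianSubgroupCount

variable {G : Type*} [CommGroup G] {p : ℕ}

/-! ## §0 The model: any `𝔽_p`-structure on `Additive G` -/

section Model

/-- In a group of exponent `p`, written additively, every element is killed by `p` (so `Additive G` carries the
`𝔽_p`-structure `AddCommGroup.zmodModule`). [folklore] -/
private theorem nsmul_eq_zero_of_pow_eq_one (hexp : ∀ g : G, g ^ p = 1) (x : Additive G) : p • x = 0 :=
  Additive.toMul.injective (by rw [toMul_nsmul, toMul_zero]; exact hexp _)

variable [Module (ZMod p) (Additive G)]

/-- The subspace attached to a subgroup (for ANY `𝔽_p`-structure on `Additive G`) has the same elements, hence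
the same order. [cite: CheboluLockridge2022, §2 («counting subspaces … is the same as counting subgroups»)] -/
private theorem natCard_toZModSubmodule (H : Subgroup G) :
    Nat.card (AddSubgroup.toZModSubmodule p (Subgroup.toAddSubgroup H)) = Nat.card H :=
  Nat.card_congr
    { toFun := fun x => ⟨Additive.toMul x.1, x.2⟩
      invFun := fun x => ⟨Additive.ofMul x.1, x.2⟩
      left_inv := fun _ => rfl
      right_inv := fun _ => rfl }

variable [hp : Fact p.Prime] [Finite G]

/-- `#Y = p^{dim Y}`, so `#Y = pᵈ ⟺ dim Y = d`, for a subspace `Y` of the finite `𝔽_p`-space `Additive G`.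
[cite: CheboluLockridge2022, §2 Theorem 2.2] -/
private theorem natCard_eq_pow_iff (Y : Submodule (ZMod p) (Additive G)) (d : ℕ) :
    Nat.card Y = p ^ d ↔ finrank (ZMod p) Y = d := by
  haveI : Module.Finite (ZMod p) Y := Module.Finite.of_finite
  rw [Module.natCard_eq_pow_finrank (K := ZMod p) (V := Y), Nat.card_zmod]
  exact (Nat.pow_right_injective hp.out.two_le).eq_iff

/-- `dim_{𝔽_p} G = n` when `#G = pⁿ`. [cite: CheboluLockridge2022, §2 Theorem 2.2] -/
private theorem finrank_eq_of_natCard_eq {n : ℕ} (hG : Nat.card G = p ^ n) : finrank (ZMod p) (Additive G) = n := by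
  haveI : Module.Finite (ZMod p) (Additive G) := Module.Finite.of_finite
  have h := Module.natCard_eq_pow_finrank (K := ZMod p) (V := Additive G)
  rw [Nat.card_zmod, show Nat.card (Additive G) = Nat.card G from Nat.card_congr Additive.toMul, hG] at h
  exact ((Nat.pow_right_injective hp.out.two_le) h).symm

/-- The model count of §1 (any `𝔽_p`-structure): subgroups of order `pᵈ` = `d`-dimensional subspaces, counted
by Cohn's Theorem 1. [cite: CheboluLockridge2022, §2 Theorem 2.2] [cite: Cohn2004, Thm. 1] -/
private theorem model_natCard_subgroup {n : ℕ} (hG : Nat.card G = p ^ n) (d : ℕ) :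
    (Nat.card {H : Subgroup G // Nat.card H = p ^ d} : ℤ) = qBinomial (p : ℤ) n d := by
  have hk : ((Nat.card (ZMod p) : ℕ) : ℤ) = p := by rw [Nat.card_zmod]
  have key := card_finrank_eq_qBinomial (k := ZMod p) (W := Additive G) d
  rw [hk, finrank_eq_of_natCard_eq (p := p) hG] at key
  rw [← key]
  congr 1
  exact Nat.card_congr ((Subgroup.toAddSubgroup.trans (AddSubgroup.toZModSubmodule p)).toEquiv.subtypeEquiv
    fun H => by
      show Nat.card H = p ^ d ↔
        finrank (ZMod p) (AddSubgroup.toZModSubmodule p (Subgroup.toAddSubgroup H)) = d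
      rw [← natCard_eq_pow_iff, natCard_toZModSubmodule])

/-- The model count of §2 (any `𝔽_p`-structure): subgroups of order `p^{d+1}` through `ρ` = `(d+1)`-dimensional
subspaces through the line `𝔽_p ρ`, counted by Hirschfeld's Theorem 3.1.1 (iii). [cite: Hirschfeld1979, Thm 3.1.1 (iii)]
[cite: CheboluLockridge2022, §2 Theorem 2.2] -/
private theorem model_natCard_subgroup_mem {n : ℕ} (hG : Nat.card G = p ^ n) {ρ : G} (hρ : ρ ≠ 1) (d : ℕ) :
    (Nat.card {H : Subgroup G // Nat.card H = p ^ (d + 1) ∧ ρ ∈ H} : ℤ) = qBinomial (p : ℤ) (n - 1) d := by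
  have hv : (Additive.ofMul ρ : Additive G) ≠ 0 := fun h => hρ (by simpa using congrArg Additive.toMul h)
  set S : Submodule (ZMod p) (Additive G) := Submodule.span (ZMod p) {Additive.ofMul ρ} with hSdef
  have hS1 : finrank (ZMod p) S = 1 := finrank_span_singleton (K := ZMod p) hv
  have key := card_subspaces_containing_eq_qBinomial (k := ZMod p) (V := Additive G) S (d := d + 1)
    (by rw [hS1]; exact Nat.le_add_left 1 d)
  rw [hS1, finrank_eq_of_natCard_eq (p := p) hG, Nat.card_zmod, Nat.add_sub_cancel] at key
  rw [← key]
  congr 1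
  exact Nat.card_congr ((Subgroup.toAddSubgroup.trans (AddSubgroup.toZModSubmodule p)).toEquiv.subtypeEquiv
    fun H => by
      show Nat.card H = p ^ (d + 1) ∧ ρ ∈ H ↔
        S ≤ AddSubgroup.toZModSubmodule p (Subgroup.toAddSubgroup H) ∧
          finrank (ZMod p) (AddSubgroup.toZModSubmodule p (Subgroup.toAddSubgroup H)) = d + 1
      rw [and_comm, ← natCard_eq_pow_iff, natCard_toZModSubmodule, hSdef, Submodule.span_singleton_le_iff_mem]
      exact Iff.rfl)

end Model

variable [hp : Fact p.Prime]

/-! ## §1 All subgroups of order `pᵈ`: `[n; d]_p` -/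

section All

/-- **THE SUBGROUPS OF ORDER `pᵈ` OF AN ELEMENTARY ABELIAN GROUP OF ORDER `pⁿ` NUMBER `[n; d]_p`** (the
`d`-dimensional subspaces of `𝔽_pⁿ`; both sides vanish for `d > n`).  Multiplicative, instance-free form: `G`
any finite commutative group with `g^p = 1` for all `g`. [cite: CheboluLockridge2022, §2 Theorem 2.2 and §3 Lemma 3.2]
[cite: Cohn2004, Thm. 1] -/
theorem natCard_subgroup_eq_qBinomial [Finite G] (hexp : ∀ g : G, g ^ p = 1) {n : ℕ}
    (hG : Nat.card G = p ^ n) (d : ℕ) :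
    (Nat.card {H : Subgroup G // Nat.card H = p ^ d} : ℤ) = qBinomial (p : ℤ) n d :=
  @model_natCard_subgroup G _ p (AddCommGroup.zmodModule (nsmul_eq_zero_of_pow_eq_one hexp)) hp _ n hG d

/-- The order of a finite group of prime exponent `p` is a power of `p` (so §1 always applies with some `n`).
[folklore] [cite: CheboluLockridge2022, §3 (a finite `p`-group)] -/
theorem exists_natCard_eq_pow [Finite G] (hexp : ∀ g : G, g ^ p = 1) : ∃ n : ℕ, Nat.card G = p ^ n := by
  have hpg : IsPGroup p G := fun g => ⟨1, by rw [pow_one]; exact hexp g⟩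
  exact IsPGroup.iff_card.1 hpg

end All

/-! ## §2 Subgroups of order `p^{d+1}` through a given `ρ ≠ 1`: `[n−1; d]_p` -/

section Through

/-- **THE SUBGROUPS OF ORDER `p^{d+1}` CONTAINING A GIVEN `ρ ≠ 1` NUMBER `[n−1; d]_p`** (`#G = pⁿ`): they are
the `(d+1)`-dimensional subspaces through the line `𝔽_p ρ`, i.e. the `d`-dimensional subspaces of
`G/⟨ρ⟩ ≅ 𝔽_p^{n−1}`. [cite: Hirschfeld1979, Thm 3.1.1 (iii)] [cite: CheboluLockridge2022, §2 Theorem 2.2 and §3 Lemma 3.2] -/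
theorem natCard_subgroup_mem_eq_qBinomial [Finite G] (hexp : ∀ g : G, g ^ p = 1) {n : ℕ}
    (hG : Nat.card G = p ^ n) {ρ : G} (hρ : ρ ≠ 1) (d : ℕ) :
    (Nat.card {H : Subgroup G // Nat.card H = p ^ (d + 1) ∧ ρ ∈ H} : ℤ) = qBinomial (p : ℤ) (n - 1) d :=
  @model_natCard_subgroup_mem G _ p (AddCommGroup.zmodModule (nsmul_eq_zero_of_pow_eq_one hexp)) hp _ n hG ρ hρ d

omit hp in
/-- No subgroup of order `p⁰ = 1` contains `ρ ≠ 1` (the `e = 0` companion of the previous count). [folklore] -/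
private theorem natCard_subgroup_mem_eq_zero [Finite G] {ρ : G} (hρ : ρ ≠ 1) :
    Nat.card {H : Subgroup G // Nat.card H = p ^ 0 ∧ ρ ∈ H} = 0 := by
  rw [Nat.card_eq_zero]
  left
  refine ⟨fun ⟨H, h1, hmem⟩ => ?_⟩
  rw [pow_zero, Subgroup.card_eq_one] at h1
  rw [h1] at hmem
  exact hρ (Subgroup.mem_bot.1 hmem)

end Through

/-! ## §3 Subgroups of order `pᵈ` avoiding `ρ`: `pᵈ·[n−1; d]_p` -/

section Avoiding

omit hp in
/-- Bookkeeping: `#{H : #H = m, ρ ∉ H} = #{H : #H = m} − #{H : #H = m, ρ ∈ H}`. [folklore] -/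
private theorem natCard_not_mem_eq_sub [Finite G] (ρ : G) (m : ℕ) :
    (Nat.card {H : Subgroup G // Nat.card H = m ∧ ρ ∉ H} : ℤ) =
      Nat.card {H : Subgroup G // Nat.card H = m} - Nat.card {H : Subgroup G // Nat.card H = m ∧ ρ ∈ H} := by
  haveI : Fintype G := Fintype.ofFinite G
  rw [Nat.card_eq_fintype_card, Nat.card_eq_fintype_card, Nat.card_eq_fintype_card, Fintype.card_subtype,
    Fintype.card_subtype, Fintype.card_subtype]
  have h := Finset.card_filter_add_card_filter_not
    (s := (univ : Finset (Subgroup G)).filter fun H : Subgroup G => Nat.card H = m) (fun H : Subgroup G => ρ ∈ H)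
  rw [Finset.filter_filter, Finset.filter_filter] at h
  omega

/-- **THE SUBGROUPS OF ORDER `pᵈ` AVOIDING A GIVEN `ρ ≠ 1` NUMBER `pᵈ·[n; d]_p` WHEN `#G = p^{n+1}`**:
`#{H ≤ G : #H = pᵈ, ρ ∉ H} = pᵈ·[n; d]_p` — all subgroups, `[n+1; d]_p`, minus those through `ρ`, `[n; d−1]_p`,
and the `q`-Pascal rule `[n+1; d]_p = pᵈ[n; d]_p + [n; d−1]_p` (for `d = 0`: the trivial subgroup,
`1 = p⁰[n; 0]_p`).  Equivalently: over each `d`-dimensional subspace `Y` of `G/⟨ρ⟩` lie exactly `pᵈ`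
subgroups `H ∌ ρ` (the complements of `⟨ρ⟩` in the preimage of `Y`). [cite: CheboluLockridge2022, §2 Theorem 2.2 and §3 Lemma 3.2]
[cite: Hirschfeld1979, Thm 3.1.1 (iii)] [cite: Cohn2004, §2 (2) (the `q`-Pascal recurrence)] -/
theorem natCard_subgroup_not_mem_eq [Finite G] (hexp : ∀ g : G, g ^ p = 1) {n : ℕ}
    (hG : Nat.card G = p ^ (n + 1)) {ρ : G} (hρ : ρ ≠ 1) (d : ℕ) :
    (Nat.card {H : Subgroup G // Nat.card H = p ^ d ∧ ρ ∉ H} : ℤ) = (p : ℤ) ^ d * qBinomial (p : ℤ) n d := by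
  rw [natCard_not_mem_eq_sub, natCard_subgroup_eq_qBinomial hexp hG d]
  cases d with
  | zero => rw [natCard_subgroup_mem_eq_zero hρ]; simp
  | succ d =>
    rw [natCard_subgroup_mem_eq_qBinomial hexp hG hρ d, Nat.add_sub_cancel, qBinomial_succ_succ]
    ring

/-- **EXACTLY `pⁿ` HYPERPLANES AVOID `ρ`**: for `#G = p^{n+1}` the subgroups of index `p` (order `pⁿ`) not
containing `ρ ≠ 1` number `pⁿ·[n; n]_p = pⁿ` (dually: the `pⁿ` characters `χ` with `χ(ρ) ≠ 1`, up to scalars).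
[cite: CheboluLockridge2022, §3 Lemma 3.2 («there are `(pⁿ−1)/(p−1)` maximal subgroups»)] [cite: Hirschfeld1979, Thm 3.1.1 (iii)] -/
theorem natCard_subgroup_not_mem_index_eq [Finite G] (hexp : ∀ g : G, g ^ p = 1) {n : ℕ}
    (hG : Nat.card G = p ^ (n + 1)) {ρ : G} (hρ : ρ ≠ 1) :
    Nat.card {H : Subgroup G // Nat.card H = p ^ n ∧ ρ ∉ H} = p ^ n := by
  have h := natCard_subgroup_not_mem_eq hexp hG hρ n
  rw [qBinomial_self, mul_one] at h
  exact_mod_cast h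

/-- All subgroups avoiding `ρ`, summed over the orders: `Σ_{d ≤ n} pᵈ[n; d]_p` of them (`#G = p^{n+1}`); stated
as the partition of `{H : ρ ∉ H}` by `#H ∈ {p⁰, …, pⁿ}` (a subgroup avoiding `ρ` is proper, of order `pᵈ`,
`d ≤ n`). [cite: CheboluLockridge2022, §2 Theorem 2.2 and §3 Lemma 3.2] -/
theorem natCard_subgroup_not_mem_eq_sum [Finite G] (hexp : ∀ g : G, g ^ p = 1) {n : ℕ}
    (hG : Nat.card G = p ^ (n + 1)) {ρ : G} (hρ : ρ ≠ 1) :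
    (Nat.card {H : Subgroup G // ρ ∉ H} : ℤ) = ∑ d ∈ range (n + 1), (p : ℤ) ^ d * qBinomial (p : ℤ) n d := by
  haveI : Fintype G := Fintype.ofFinite G
  -- partition `{H : ρ ∉ H}` by the exponent `d` of `#H = pᵈ`, `d ≤ n`
  have horder : ∀ H : Subgroup G, ρ ∉ H → ∃ d ∈ range (n + 1), Nat.card H = p ^ d := by
    intro H hρH
    obtain ⟨d, hd, hdcard⟩ := (Nat.dvd_prime_pow hp.out).1
      (show Nat.card H ∣ p ^ (n + 1) from hG ▸ Subgroup.card_subgroup_dvd_card H)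
    refine ⟨d, mem_range.2 (Nat.lt_of_le_of_ne hd fun hdn => hρH ?_), hdcard⟩
    -- `d = n + 1` would force `H = ⊤ ∋ ρ`
    have htop : H = ⊤ := Subgroup.eq_top_of_card_eq H (by rw [hdcard, hdn, hG])
    rw [htop]; exact Subgroup.mem_top ρ
  -- the partition, in `Finset` language
  have hpart : ((univ : Finset (Subgroup G)).filter fun H : Subgroup G => ρ ∉ H) = (range (n + 1)).biUnion fun d : ℕ =>
      (univ : Finset (Subgroup G)).filter fun H : Subgroup G => Nat.card H = p ^ d ∧ ρ ∉ H := by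
    ext H
    simp only [mem_filter, mem_univ, true_and, mem_biUnion]
    constructor
    · intro hρH
      obtain ⟨d, hd, hdcard⟩ := horder H hρH
      exact ⟨d, hd, hdcard, hρH⟩
    · rintro ⟨d, -, -, hρH⟩
      exact hρH
  have hdisj : Set.PairwiseDisjoint (↑(range (n + 1)) : Set ℕ) fun d =>
      (univ : Finset (Subgroup G)).filter fun H : Subgroup G => Nat.card H = p ^ d ∧ ρ ∉ H := by
    intro d _ d' _ hdd'
    rw [Function.onFun, disjoint_left]
    intro H hH hH'
    have h1 := (mem_filter.1 hH).2.1
    have h2 := (mem_filter.1 hH').2.1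
    rw [h1] at h2
    exact hdd' (Nat.pow_right_injective hp.out.two_le h2)
  rw [Nat.card_eq_fintype_card, Fintype.card_subtype, hpart, card_biUnion hdisj, Nat.cast_sum]
  refine sum_congr rfl fun d _ => ?_
  rw [← natCard_subgroup_not_mem_eq hexp hG hρ d, Nat.card_eq_fintype_card, Fintype.card_subtype]

end Avoiding

/-! ## §4 The same counts as `Finset.filter` cardinalities -/

section Finset

variable [Fintype G]

/-- §1 in `Finset` form: `#{H ≤ G : #H = pᵈ} = [n; d]_p`. [cite: CheboluLockridge2022, §2 Theorem 2.2 and §3 Lemma 3.2]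
[cite: Cohn2004, Thm. 1] -/
theorem card_filter_natCard_eq (hexp : ∀ g : G, g ^ p = 1) {n : ℕ} (hG : Fintype.card G = p ^ n) (d : ℕ) :
    ((((univ : Finset (Subgroup G)).filter fun H : Subgroup G => Nat.card H = p ^ d).card : ℕ) : ℤ) = qBinomial (p : ℤ) n d := by
  rw [← natCard_subgroup_eq_qBinomial hexp (by rw [Nat.card_eq_fintype_card, hG]) d, Nat.card_eq_fintype_card,
    Fintype.card_subtype]

/-- §2 in `Finset` form: `#{H : #H = p^{d+1}, ρ ∈ H} = [n−1; d]_p`. [cite: Hirschfeld1979, Thm 3.1.1 (iii)]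
[cite: CheboluLockridge2022, §2 Theorem 2.2] -/
theorem card_filter_natCard_eq_mem (hexp : ∀ g : G, g ^ p = 1) {n : ℕ} (hG : Fintype.card G = p ^ n) {ρ : G}
    (hρ : ρ ≠ 1) (d : ℕ) :
    ((((univ : Finset (Subgroup G)).filter fun H : Subgroup G => Nat.card H = p ^ (d + 1) ∧ ρ ∈ H).card : ℕ) : ℤ) =
      qBinomial (p : ℤ) (n - 1) d := by
  rw [← natCard_subgroup_mem_eq_qBinomial hexp (by rw [Nat.card_eq_fintype_card, hG]) hρ d, Nat.card_eq_fintype_card,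
    Fintype.card_subtype]

/-- §3 in `Finset` form: `#{H : #H = pᵈ, ρ ∉ H} = pᵈ·[n; d]_p` for `#G = p^{n+1}`.
[cite: CheboluLockridge2022, §2 Theorem 2.2 and §3 Lemma 3.2] [cite: Hirschfeld1979, Thm 3.1.1 (iii)] -/
theorem card_filter_natCard_eq_not_mem (hexp : ∀ g : G, g ^ p = 1) {n : ℕ} (hG : Fintype.card G = p ^ (n + 1))
    {ρ : G} (hρ : ρ ≠ 1) (d : ℕ) :
    ((((univ : Finset (Subgroup G)).filter fun H : Subgroup G => Nat.card H = p ^ d ∧ ρ ∉ H).card : ℕ) : ℤ) =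
      (p : ℤ) ^ d * qBinomial (p : ℤ) n d := by
  rw [← natCard_subgroup_not_mem_eq hexp (by rw [Nat.card_eq_fintype_card, hG]) hρ d, Nat.card_eq_fintype_card,
    Fintype.card_subtype]

/-- The hyperplanes avoiding `ρ`, `Finset` form: `#{H : #H = pⁿ, ρ ∉ H} = pⁿ` for `#G = p^{n+1}`.
[cite: CheboluLockridge2022, §3 Lemma 3.2] -/
theorem card_filter_natCard_eq_not_mem_index (hexp : ∀ g : G, g ^ p = 1) {n : ℕ}
    (hG : Fintype.card G = p ^ (n + 1)) {ρ : G} (hρ : ρ ≠ 1) :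
    ((univ : Finset (Subgroup G)).filter fun H : Subgroup G => Nat.card H = p ^ n ∧ ρ ∉ H).card = p ^ n := by
  have h := natCard_subgroup_not_mem_index_eq hexp (by rw [Nat.card_eq_fintype_card, hG]) hρ
  rw [Nat.card_eq_fintype_card, Fintype.card_subtype] at h
  exact h

end Finset

/-! ## §5 `p = 2`: the tables for the exponent-`2` groups of order `8, 16, 32, 64` -/

section Two

variable [Fintype G] {ρ : G}

/-- Numeric engine: for `#G = 2^{n+1}` and `ρ ≠ 1`, `#{H : #H = 2ᵈ, ρ ∉ H} = 2ᵈ·[n; d]_2`, read in `ℕ` once the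
right side is evaluated. [cite: CheboluLockridge2022, §2 Theorem 2.2] -/
private theorem card_filter_two_not_mem_eq_of_eq (hexp : ∀ g : G, g ^ 2 = 1) {n : ℕ}
    (hG : Fintype.card G = 2 ^ (n + 1)) (hρ : ρ ≠ 1) (d : ℕ) {m N : ℕ} (hm : 2 ^ d = m)
    (hN : (2 : ℤ) ^ d * qBinomial (2 : ℤ) n d = N) :
    ((univ : Finset (Subgroup G)).filter fun H : Subgroup G => Nat.card H = m ∧ ρ ∉ H).card = N := by
  have h := card_filter_natCard_eq_not_mem (p := 2) hexp hG hρ d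
  push_cast at h
  rw [hN, hm] at h
  exact_mod_cast h

/-- **ORDER `64` (`(ℤ/2)⁶`, `ρ ≠ 1`): the subgroups `W ∌ ρ` number `62` of order `2`, `620` of order `4`, `1240`
of order `8`, `496` of order `16`, `32` of order `32`** (`2ᵈ·[5; d]_2`: `2·31`, `4·155`, `8·155`, `16·31`,
`32·1`). [cite: CheboluLockridge2022, §2 Theorem 2.2 and §3 Lemma 3.2] [cite: Hirschfeld1979, Thm 3.1.1 (iii)] -/
theorem card_filter_not_mem_of_card_eq_sixtyFour (hexp : ∀ g : G, g ^ 2 = 1) (h64 : Fintype.card G = 64)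
    (hρ : ρ ≠ 1) :
    ((univ : Finset (Subgroup G)).filter fun H : Subgroup G => Nat.card H = 2 ∧ ρ ∉ H).card = 62 ∧
      ((univ : Finset (Subgroup G)).filter fun H : Subgroup G => Nat.card H = 4 ∧ ρ ∉ H).card = 620 ∧
      ((univ : Finset (Subgroup G)).filter fun H : Subgroup G => Nat.card H = 8 ∧ ρ ∉ H).card = 1240 ∧
      ((univ : Finset (Subgroup G)).filter fun H : Subgroup G => Nat.card H = 16 ∧ ρ ∉ H).card = 496 ∧
      ((univ : Finset (Subgroup G)).filter fun H : Subgroup G => Nat.card H = 32 ∧ ρ ∉ H).card = 32 := by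
  have hG : Fintype.card G = 2 ^ (5 + 1) := by rw [h64]; norm_num
  exact ⟨card_filter_two_not_mem_eq_of_eq hexp hG hρ 1 (by norm_num) (by norm_num [qBinomial]),
    card_filter_two_not_mem_eq_of_eq hexp hG hρ 2 (by norm_num) (by norm_num [qBinomial]),
    card_filter_two_not_mem_eq_of_eq hexp hG hρ 3 (by norm_num) (by norm_num [qBinomial]),
    card_filter_two_not_mem_eq_of_eq hexp hG hρ 4 (by norm_num) (by norm_num [qBinomial]),
    card_filter_two_not_mem_eq_of_eq hexp hG hρ 5 (by norm_num) (by norm_num [qBinomial])⟩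

/-- Order `64`: `1395 = [6; 3]_2` subgroups of order `8` in all, `155 = [5; 2]_2` of them through `ρ`
(`1395 = 155 + 1240`). [cite: CheboluLockridge2022, §2 Theorem 2.2] [cite: Cohn2004, Thm. 1]
[cite: Hirschfeld1979, Thm 3.1.1 (iii)] -/
theorem card_filter_eight_of_card_eq_sixtyFour (hexp : ∀ g : G, g ^ 2 = 1) (h64 : Fintype.card G = 64)
    (hρ : ρ ≠ 1) :
    ((univ : Finset (Subgroup G)).filter fun H : Subgroup G => Nat.card H = 8).card = 1395 ∧
      ((univ : Finset (Subgroup G)).filter fun H : Subgroup G => Nat.card H = 8 ∧ ρ ∈ H).card = 155 := by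
  have hG : Fintype.card G = 2 ^ 6 := by rw [h64]; norm_num
  have h1 := card_filter_natCard_eq (p := 2) hexp hG 3
  have h2 := card_filter_natCard_eq_mem (p := 2) hexp hG hρ 2
  have e1 : qBinomial (2 : ℤ) 6 3 = 1395 := by norm_num [qBinomial]
  have e2 : qBinomial (2 : ℤ) 5 2 = 155 := by norm_num [qBinomial]
  push_cast at h1 h2
  rw [e1] at h1
  rw [e2] at h2
  exact ⟨by exact_mod_cast h1, by exact_mod_cast h2⟩

/-- **ORDER `32` (`(ℤ/2)⁵`): the subgroups `W ∌ ρ` number `30, 140, 120, 16` of order `2, 4, 8, 16`**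
(`2·15`, `4·35`, `8·15`, `16·1`). [cite: CheboluLockridge2022, §2 Theorem 2.2 and §3 Lemma 3.2] [cite: Hirschfeld1979, Thm 3.1.1 (iii)] -/
theorem card_filter_not_mem_of_card_eq_thirtyTwo (hexp : ∀ g : G, g ^ 2 = 1) (h32 : Fintype.card G = 32)
    (hρ : ρ ≠ 1) :
    ((univ : Finset (Subgroup G)).filter fun H : Subgroup G => Nat.card H = 2 ∧ ρ ∉ H).card = 30 ∧
      ((univ : Finset (Subgroup G)).filter fun H : Subgroup G => Nat.card H = 4 ∧ ρ ∉ H).card = 140 ∧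
      ((univ : Finset (Subgroup G)).filter fun H : Subgroup G => Nat.card H = 8 ∧ ρ ∉ H).card = 120 ∧
      ((univ : Finset (Subgroup G)).filter fun H : Subgroup G => Nat.card H = 16 ∧ ρ ∉ H).card = 16 := by
  have hG : Fintype.card G = 2 ^ (4 + 1) := by rw [h32]; norm_num
  exact ⟨card_filter_two_not_mem_eq_of_eq hexp hG hρ 1 (by norm_num) (by norm_num [qBinomial]),
    card_filter_two_not_mem_eq_of_eq hexp hG hρ 2 (by norm_num) (by norm_num [qBinomial]),
    card_filter_two_not_mem_eq_of_eq hexp hG hρ 3 (by norm_num) (by norm_num [qBinomial]),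
    card_filter_two_not_mem_eq_of_eq hexp hG hρ 4 (by norm_num) (by norm_num [qBinomial])⟩

/-- **ORDER `16` (`(ℤ/2)⁴`): the subgroups `W ∌ ρ` number `14, 28, 8` of order `2, 4, 8`** (`2·7`, `4·7`, `8·1`).
[cite: CheboluLockridge2022, §2 Theorem 2.2 and §3 Lemma 3.2] [cite: Hirschfeld1979, Thm 3.1.1 (iii)] -/
theorem card_filter_not_mem_of_card_eq_sixteen (hexp : ∀ g : G, g ^ 2 = 1) (h16 : Fintype.card G = 16)
    (hρ : ρ ≠ 1) :
    ((univ : Finset (Subgroup G)).filter fun H : Subgroup G => Nat.card H = 2 ∧ ρ ∉ H).card = 14 ∧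
      ((univ : Finset (Subgroup G)).filter fun H : Subgroup G => Nat.card H = 4 ∧ ρ ∉ H).card = 28 ∧
      ((univ : Finset (Subgroup G)).filter fun H : Subgroup G => Nat.card H = 8 ∧ ρ ∉ H).card = 8 := by
  have hG : Fintype.card G = 2 ^ (3 + 1) := by rw [h16]; norm_num
  exact ⟨card_filter_two_not_mem_eq_of_eq hexp hG hρ 1 (by norm_num) (by norm_num [qBinomial]),
    card_filter_two_not_mem_eq_of_eq hexp hG hρ 2 (by norm_num) (by norm_num [qBinomial]),
    card_filter_two_not_mem_eq_of_eq hexp hG hρ 3 (by norm_num) (by norm_num [qBinomial])⟩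

/-- **ORDER `8` (`(ℤ/2)³`): the subgroups `W ∌ ρ` number `6` of order `2` and `4` of order `4`**; with the
trivial subgroup, `11` of the `16` subgroups avoid `ρ`. [cite: CheboluLockridge2022, §2 Theorem 2.2 and §3 Lemma 3.2] -/
theorem card_filter_not_mem_of_card_eq_eight (hexp : ∀ g : G, g ^ 2 = 1) (h8 : Fintype.card G = 8)
    (hρ : ρ ≠ 1) :
    ((univ : Finset (Subgroup G)).filter fun H : Subgroup G => Nat.card H = 1 ∧ ρ ∉ H).card = 1 ∧
      ((univ : Finset (Subgroup G)).filter fun H : Subgroup G => Nat.card H = 2 ∧ ρ ∉ H).card = 6 ∧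
      ((univ : Finset (Subgroup G)).filter fun H : Subgroup G => Nat.card H = 4 ∧ ρ ∉ H).card = 4 := by
  have hG : Fintype.card G = 2 ^ (2 + 1) := by rw [h8]; norm_num
  exact ⟨card_filter_two_not_mem_eq_of_eq hexp hG hρ 0 (by norm_num) (by norm_num [qBinomial]),
    card_filter_two_not_mem_eq_of_eq hexp hG hρ 1 (by norm_num) (by norm_num [qBinomial]),
    card_filter_two_not_mem_eq_of_eq hexp hG hρ 2 (by norm_num) (by norm_num [qBinomial])⟩

/-- **ORDER `64`: in all `2451 = Σ_d 2ᵈ[5; d]_2` subgroups avoid `ρ`** (`1 + 62 + 620 + 1240 + 496 + 32`; these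
are the candidate stabilisers `Stab(T) ∌ ρ` of CM types on the group of order `64`).
[cite: CheboluLockridge2022, §2 Theorem 2.2 and §3 Lemma 3.2] -/
theorem card_filter_not_mem_eq_of_card_eq_sixtyFour (hexp : ∀ g : G, g ^ 2 = 1) (h64 : Fintype.card G = 64)
    (hρ : ρ ≠ 1) : ((univ : Finset (Subgroup G)).filter fun H : Subgroup G => ρ ∉ H).card = 2451 := by
  have h := natCard_subgroup_not_mem_eq_sum (p := 2) hexp (n := 5)
    (by rw [Nat.card_eq_fintype_card, h64]; norm_num) hρ
  have e : ∑ d ∈ range (5 + 1), (2 : ℤ) ^ d * qBinomial (2 : ℤ) 5 d = 2451 := by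
    norm_num [qBinomial, Finset.sum_range_succ]
  rw [Nat.card_eq_fintype_card, Fintype.card_subtype] at h
  push_cast at h
  rw [e] at h
  exact_mod_cast h

end Two

end ElementaryAbelianSubgroupCount

end Literature.GroupTheory.FiniteAbelian
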